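import Summits.Ventures.LatticeQCDFlow.Scoring.U1TorusTopologicalChargeLaw
import Summits.Ventures.LatticeQCDFlow.Scoring.U1AngleWeightFourierCoefficients
import Mathlib.Analysis.Fourier.PoissonSummation
import HarnessLib

/-!
# The partition function of 2-d `U(1)` on `(ℤ/L)²` in Bessel form, by Poisson summation over the topological sectors

HONEST FRAMING: exact (Metropolis-corrected) sampling algorithms for lattice gauge theory;
figures of merit are autocorrelation/cost numbers at stated couplings and volumes; no
continuum-physics claim.

Venture `LatticeQCDFlow` (cell pub-lqcd), sub-topic `Scoring`; FANOUT row 5 (`s0-sun-a`), GEN-8.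
NEW WORK of the cell (placement rule).  `Scoring/U1TorusTopologicalChargeLaw.lean` writes theory-2's
partition function of compact `U(1)` on `Λ = (ℤ/L)²` as a sum over topological sectors,
`Z_{Λ,β} = (2π)^{−(V−1)} Σ_{k∈ℤ} g_V(2πk)`, `g_V = p_β^{*V}`, `V = L²`;
`Scoring/U1SectorWeightFourier.lean` gives `g_V` by Fourier inversion and
`Scoring/U1AngleWeightFourierCoefficients.lean` the values `𝓕 p_β(n/2π) = 2π e^{−β} I_{|n|}(β)`.
POISSON SUMMATION (Mathlib's `Real.tsum_eq_tsum_fourier_of_rpow_decay`, applied to the continuous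
compactly supported `x ↦ g_V(2πx)` whose Fourier transform decays like `|ξ|^{−V}`) closes the circle:

* **`tsum_cconvPow_two_pi_mul`** — `Σ_{k∈ℤ} g_V(2πk) = (2π)^{V−1} e^{−βV} Σ_{n∈ℤ} I_{|n|}(β)^V` (`V ≥ 2`);
* **`tsum_u1SectorWeight_toReal`** — the same for the `[0,∞]`-valued sector weights;
* **`u1_partitionFunction_two_eq_besselI`** — for every `L ≥ 2` and real `β`:
  `partitionFunction u1Rep β = e^{−βL²} · Σ_{n∈ℤ} I_{|n|}(β)^{L²}` (theory-2's abstract Haar-measure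
  partition function of `Literature…ConstructiveQFTWave0` = the Bessel character sum of the cell's
  oracle, `logZ = log Σ_n I_n(β)^V` in `ORACLE-u1-2d.json` up to the constant `βV` of the action
  convention) — a derivation INDEPENDENT of the character expansion in box coordinates
  (`Scoring/U1TorusCharacterFormula.lean`, `u1WilsonZ = (2π)^{2V} Σ_k I_k^V`);
* **`wilsonMeasure_topCharge_toReal_eq_besselI`** — `P(Q = k) = e^{βV} g_V(2πk) / ((2π)^{V−1} Σ_n I_{|n|}(β)^V)`.

Elementary on top of Mathlib; nothing new is cited (Poisson summation: Stein–Weiss VII.2.6 as in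
Mathlib's docstring).
-/

noncomputable section

open MeasureTheory Set Real Filter Topology Complex Asymptotics
open scoped ENNReal Convolution FourierTransform
open Literature.Analysis.FunctionSpaces
open Literature.MathematicalPhysics.QuantumFieldTheory
open Literature.MathematicalPhysics.QuantumLattice (u1Rep)
open Summit.Ventures.LatticeQCDFlow.Theory2.Lattice (topCharge)

namespace Summit.Ventures.LatticeQCDFlow.Scoring

variable (β : ℝ)

/-! ### 1. The rescaled sector-weight function `x ↦ g_V(2πx)` and its Fourier transform -/

/-- The Fourier transform of `x ↦ p_β^{*(m+2)}(2πx)`: `(2π)⁻¹ (𝓕 p_β (ξ/2π))^{m+2}`. -/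
theorem fourier_cconvPow_two_pi_mul (m : ℕ) (ξ : ℝ) :
    𝓕 (fun x : ℝ => cconvPow β (m + 1) (2 * π * x)) ξ =
      (((2 * π)⁻¹ : ℝ) : ℂ) * (𝓕 (u1AngleWeightC β) (ξ / (2 * π))) ^ (m + 2) := by
  rw [fourier_comp_mul_left (cconvPow β (m + 1)) (by positivity : (2 : ℝ) * π ≠ 0),
    abs_of_pos (by positivity : (0 : ℝ) < 2 * π), fourier_cconvPow]

/-- Decay of that Fourier transform: `‖𝓕(g(2π·)) ξ‖ ≤ C · |ξ|⁻²` for `ξ ≠ 0` (`g = p_β^{*(m+2)}`). -/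
theorem norm_fourier_cconvPow_two_pi_mul_le (m : ℕ) {ξ : ℝ} (hξ : ξ ≠ 0) :
    ‖𝓕 (fun x : ℝ => cconvPow β (m + 1) (2 * π * x)) ξ‖ ≤
      (2 * π)⁻¹ * ((Real.exp (|β| * 2) * (2 * π)) ^ m *
        (2 * Real.exp (|β| * 2) * (1 + π * |β|)) ^ 2) * |ξ| ^ (-(2 : ℝ)) := by
  set A := Real.exp (|β| * 2) * (2 * π) with hA
  set B := Real.exp (|β| * 2) * (1 + π * |β|) with hB
  have hξ' : ξ / (2 * π) ≠ 0 := div_ne_zero hξ (by positivity)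
  have h1 : ‖𝓕 (u1AngleWeightC β) (ξ / (2 * π))‖ ≤ A := norm_fourier_u1AngleWeightC_le β _
  have h2 : ‖𝓕 (u1AngleWeightC β) (ξ / (2 * π))‖ ≤ 2 * B / |ξ| := by
    have h := norm_fourier_u1AngleWeightC_le_inv β hξ'
    rw [abs_div, abs_of_pos (by positivity : (0 : ℝ) < 2 * π)] at h
    convert h using 1
    rw [hB]; field_simp
  rw [fourier_cconvPow_two_pi_mul, norm_mul, Complex.norm_real, Real.norm_eq_abs,
    abs_of_pos (by positivity : (0 : ℝ) < (2 * π)⁻¹), norm_pow, pow_add,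
    Real.rpow_neg (abs_nonneg ξ), Real.rpow_two, sq_abs]
  have hF0 := norm_nonneg (𝓕 (u1AngleWeightC β) (ξ / (2 * π)))
  have hsq : ‖𝓕 (u1AngleWeightC β) (ξ / (2 * π))‖ ^ 2 ≤ (2 * B) ^ 2 * (ξ ^ 2)⁻¹ := by
    have := pow_le_pow_left₀ hF0 h2 2
    rwa [div_pow, sq_abs, div_eq_mul_inv] at this
  have hpm : ‖𝓕 (u1AngleWeightC β) (ξ / (2 * π))‖ ^ m ≤ A ^ m := pow_le_pow_left₀ hF0 h1 m
  have hA0 : 0 ≤ A := by positivity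
  calc (2 * π)⁻¹ * (‖𝓕 (u1AngleWeightC β) (ξ / (2 * π))‖ ^ m *
          ‖𝓕 (u1AngleWeightC β) (ξ / (2 * π))‖ ^ 2)
      ≤ (2 * π)⁻¹ * (A ^ m * ((2 * B) ^ 2 * (ξ ^ 2)⁻¹)) :=
        mul_le_mul_of_nonneg_left (mul_le_mul hpm hsq (by positivity) (by positivity))
          (by positivity)
    _ = _ := by rw [hB]; ring

/-! ### 2. Poisson summation -/

/-- **`Σ_{k∈ℤ} p_β^{*(m+2)}(2πk) = (2π)^{m+1} e^{−β(m+2)} Σ_{n∈ℤ} I_{|n|}(β)^{m+2}`** (Poisson summation). -/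
theorem tsum_cconvPow_two_pi_mul (m : ℕ) :
    ∑' k : ℤ, cconvPow β (m + 1) (2 * π * k) =
      (((2 * π) ^ (m + 1) * Real.exp (-β) ^ (m + 2) * ∑' n : ℤ, besselI n.natAbs β ^ (m + 2) : ℝ) : ℂ) := by
  set F : ℝ → ℂ := fun x => cconvPow β (m + 1) (2 * π * x) with hF
  have h2π : (2 : ℝ) * π ≠ 0 := by positivity
  -- continuity and compact support of `F`
  have hcont : Continuous F := (continuous_cconvPow β (by omega : 1 ≤ m + 1)).comp (by fun_prop)
  have hsupp : HasCompactSupport F := by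
    have h := (hasCompactSupport_cconvPow β (m + 1)).comp_homeomorph (Homeomorph.mulLeft₀ (2 * π) h2π)
    exact h
  have hF0 : F =O[cocompact ℝ] fun x : ℝ => |x| ^ (-(2 : ℝ)) := by
    have hz : F =ᶠ[cocompact ℝ] 0 := by
      rw [← Filter.coclosedCompact_eq_cocompact]
      exact hasCompactSupport_iff_eventuallyEq.mp hsupp
    exact (isBigO_zero (fun x : ℝ => |x| ^ (-(2 : ℝ))) (cocompact ℝ)).congr' hz.symm EventuallyEq.rfl
  have hFF : (𝓕 F) =O[cocompact ℝ] fun x : ℝ => |x| ^ (-(2 : ℝ)) := by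
    refine IsBigO.of_bound ((2 * π)⁻¹ * ((Real.exp (|β| * 2) * (2 * π)) ^ m *
        (2 * Real.exp (|β| * 2) * (1 + π * |β|)) ^ 2)) ?_
    have hne : ∀ᶠ ξ : ℝ in cocompact ℝ, ξ ≠ 0 := by
      filter_upwards [(isCompact_singleton (x := (0 : ℝ))).compl_mem_cocompact] with ξ hξ
      simpa using hξ
    filter_upwards [hne] with ξ hξ
    rw [Real.norm_of_nonneg (Real.rpow_nonneg (abs_nonneg ξ) _)]
    exact norm_fourier_cconvPow_two_pi_mul_le β m hξ
  -- Poisson summation at `x = 0`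
  have hP := Real.tsum_eq_tsum_fourier_of_rpow_decay hcont one_lt_two hF0 hFF 0
  simp only [zero_add, QuotientAddGroup.mk_zero, fourier_eval_zero, mul_one] at hP
  -- the left side is our sum, the right side is explicit
  have hL : ∑' k : ℤ, cconvPow β (m + 1) (2 * π * k) = ∑' k : ℤ, F k := by simp only [hF]
  rw [hL, hP]
  have hR : ∀ n : ℤ, 𝓕 F n = (((2 * π)⁻¹ * (2 * π * Real.exp (-β) * besselI n.natAbs β) ^ (m + 2) : ℝ) : ℂ) := by
    intro n
    rw [hF, fourier_cconvPow_two_pi_mul, fourier_u1AngleWeightC_int_div]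
    push_cast
    ring
  simp_rw [hR]
  rw [← Complex.ofReal_tsum]
  congr 1
  rw [← tsum_mul_left]
  refine tsum_congr fun n => ?_
  have hπ : (π : ℝ) ≠ 0 := Real.pi_pos.ne'
  field_simp
  ring

/-! ### 3. The sector weights and the partition function in Bessel form -/

/-- **`Σ_k g_V(2πk) = (2π)^{V−1} e^{−βV} Σ_n I_{|n|}(β)^V`** for the `[0,∞]`-valued sector weights,
`V ≥ 2` (real form). -/
theorem tsum_u1SectorWeight_toReal {V : ℕ} (hV : 2 ≤ V) :
    (∑' k : ℤ, u1SectorWeight β V k).toReal =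
      (2 * π) ^ (V - 1) * Real.exp (-β) ^ V * ∑' n : ℤ, besselI n.natAbs β ^ V := by
  obtain ⟨m, rfl⟩ := Nat.exists_eq_add_of_le' hV
  rw [ENNReal.tsum_toReal_eq fun k => (u1SectorWeight_lt_top β _ k).ne]
  apply Complex.ofReal_injective
  rw [Complex.ofReal_tsum]
  simp_rw [u1SectorWeight_toReal]
  rw [show m + 2 - 1 = m + 1 from rfl, tsum_cconvPow_two_pi_mul]

variable {L : ℕ} [NeZero L]

/-- **THE PARTITION FUNCTION OF 2-d `U(1)` IN BESSEL FORM.**  For every `L ≥ 2` and real `β`,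
theory-2's partition function of compact `U(1)` on `(ℤ/L)²` (product Haar measure, plaquette
action `1 − Re U_p`) is `Z_{Λ,β} = e^{−βL²} Σ_{n∈ℤ} I_{|n|}(β)^{L²}`. -/
theorem u1_partitionFunction_two_eq_besselI (hL : 2 ≤ L) :
    partitionFunction (d := 2) (L := L) u1Rep β =
      ENNReal.ofReal (Real.exp (-β) ^ (L ^ 2) * ∑' n : ℤ, besselI n.natAbs β ^ (L ^ 2)) := by
  have hV : 2 ≤ L ^ 2 := by nlinarith
  obtain ⟨hZ0, hZt⟩ := u1_partitionFunction_ne (L := L) β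
  rw [← ENNReal.ofReal_toReal hZt, partitionFunction_eq_tsum_sectorWeight β hL, ENNReal.toReal_mul,
    ENNReal.toReal_pow, ENNReal.toReal_inv, ENNReal.toReal_ofReal (by positivity),
    tsum_u1SectorWeight_toReal β hV]
  congr 1
  have h2π : (2 * π : ℝ) ≠ 0 := by positivity
  rw [← mul_assoc, ← mul_assoc, ← mul_pow, inv_mul_cancel₀ h2π, one_pow, one_mul]

/-- **The sector probabilities with an explicit denominator**:
`P(Q = k) = g_V(2πk) / ((2π)^{V−1} e^{−βV} Σ_n I_{|n|}(β)^V)`, `V = L²`, `L ≥ 2`. -/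
theorem wilsonMeasure_topCharge_toReal_eq_besselI (hL : 2 ≤ L) (k : ℤ) :
    (wilsonMeasure (d := 2) (L := L) u1Rep β {U | topCharge U = k}).toReal =
      (u1SectorWeight β (L ^ 2) k).toReal /
        ((2 * π) ^ (L ^ 2 - 1) * Real.exp (-β) ^ (L ^ 2) * ∑' n : ℤ, besselI n.natAbs β ^ (L ^ 2)) := by
  have hV : 2 ≤ L ^ 2 := by nlinarith
  rw [wilsonMeasure_topCharge_toReal β hL k, tsum_u1SectorWeight_toReal β hV]

end Summit.Ventures.LatticeQCDFlow.Scoring
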